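import Literature.IUT.HodgeArakelov.LabelClassesOfCusps
import Mathlib.Topology.Instances.ZMod
import Mathlib.RingTheory.RootsOfUnity.Complex

/-!
# A kernel NON-VACUITY witness for the [IUTchII] §1–§2 setting interfaces `ThetaSetting`, `BadPlaceSetting`,
# `TemperedCoverings`, `PlusMinusTower` — the finite CYCLIC TOY

S. Mochizuki, *Inter-universal Teichmüller theory II*, kurims manuscript (Dec. 2020), §1 p. 20 (the setting:
`Π^tp_{X̲̲_v} ↠ G_v`, the model mono-theta environment), §2 Prop 2.1 pp. 64–65 (the diagram of tempered
coverings), Def 2.3 (i) p. 67 («`Δ̂_v` [is] a normal open subgroup of `Δ̂^±_v` of index `l`», «`Δ̂^±_v` [is] a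
normal open subgroup of `Δ̂^cor_v` of index `2l`») ([IUTchII] Def 2.3 (i), kurims p.67)
[claim: Mochizuki2012, status: disputed] (D-0012 claim key; nothing printed is asserted here).

CONSISTENCY WITNESS, TOY — consistency ≠ faithfulness; nothing here takes a side on anything printed.
abc-iut-L6-t1's interfaces `ThetaSetting` (MonoThetaCyclotomes.lean), `BadPlaceSetting` + `TemperedCoverings`
(ThetaEvaluationSetting.lean) and `PlusMinusTower` (LabelClassesOfCusps.lean) — consumed by 74 resp. 31 files
of the cell (every [IUTchII] §2–§3 discharge is a theorem OVER them) — had no kernel inhabitant (census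
INTERFACE-NV-CENSUS.md, abc-iut-w5-d243, row «L6-NV-1»). This file builds one for every odd prime `l` (and any
odd prime `p ≠ l`), the **cyclic toy**: all groups DISCRETE and FINITE, `G_v := 1`, `k := ℂ` (which has a
primitive `4l`-th root of unity), the model mono-theta environment trivial, and the tower of Def 2.3 (i)
realised inside the abelian group `Π̂^cor_v := ℤ/2 × ℤ/l × ℤ/l` (`Amb l`) by
`Π̂_v = Π_v := 1 ⊆ Π̂^±_v = Π^±_v = Π^tp_{X_v} := 0 × 0 × ℤ/l ⊆ Π̂^cor_v` — so the printed indices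
`[Δ̂^±_v : Δ̂_v] = l` and `[Δ̂^cor_v : Δ̂^±_v] = 2l` HOLD, the reference coverings `Π^tp_{Ÿ_v} ⊆ Π^tp_{Y_v}` are
`⊤`, and Prop 2.1's «corresponds» holds by the identity:
* `cyclicThetaSetting`, `cyclicBadPlaceSetting : BadPlaceSetting`, `cyclicCoverings : TemperedCoverings S S.PiX`,
  `cyclicTower : PlusMinusTower (cyclicCoverings …)` — every field PROVED;
* `piPM_inf_hat_le_piV`, `not_piPM_inf_ker_le_hat` — the two covering-shape side hypotheses `hinf`/`hnot` of
  abc-iut-w5-d132's `cor24_i'_of_hatData` (LabelClassesOfCuspsCor24iH25Flat.lean) hold in the toy JOINTLY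
  with all tower axioms (finding N-d243-4).
What this does NOT show: faithfulness (in print `Π_v` is an infinite tempered group, `G_v = Gal(K̄_v/K_v)`);
the degenerate choice `Π_v := 1` makes every cusp/inertia datum over the toy trivial. abc-iut cell, seat
abc-iut-w5-d243. [claim: Mochizuki2012, status: disputed] (IUTchII §2 Def 2.3 (i), kurims p.67)
-/

noncomputable section

namespace Literature.IUT.HodgeArakelov

namespace CyclicToy

open Multiplicative

variable (l : ℕ)

/-! ## 1. The ambient finite abelian group `Π̂^cor_v := ℤ/2 × ℤ/l × ℤ/l` and `Π^±_v := 0 × 0 × ℤ/l` -/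

/-- `Π̂^cor_v` of the toy: `ℤ/2 × ℤ/l × ℤ/l`, multiplicatively, discrete.
[claim: Mochizuki2012, status: disputed] (IUTchII §2 Def 2.3 (i), kurims p.67) -/
abbrev Amb : Type := Multiplicative (ZMod 2 × (ZMod l × ZMod l))

/-- The embedding `c ↦ (0, 0, c)` of `ℤ/l` (its image plays `Π̂^±_v = Π^±_v`).
[claim: Mochizuki2012, status: disputed] (IUTchII §2 Def 2.3 (i), kurims p.67) -/
def ιpm : Multiplicative (ZMod l) →* Amb l :=
  AddMonoidHom.toMultiplicative
    ((AddMonoidHom.inr (ZMod 2) (ZMod l × ZMod l)).comp (AddMonoidHom.inr (ZMod l) (ZMod l)))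

/-- `ιpm` is injective. [claim: Mochizuki2012, status: disputed] (IUTchII §2 Def 2.3 (i), kurims p.67) -/
theorem ιpm_injective : Function.Injective (ιpm l) := by
  intro a b h
  have h' := congrArg (fun x : Amb l => (toAdd x).2.2) h
  simpa [ιpm] using h'

/-- `Π̂^±_v = Π^±_v` of the toy: the subgroup `0 × 0 × ℤ/l`.
[claim: Mochizuki2012, status: disputed] (IUTchII §2 Def 2.3 (i), kurims p.67) -/
def Hpm : Subgroup (Amb l) := (ιpm l).range

/-- `|Π^±_v| = l`. [claim: Mochizuki2012, status: disputed] (IUTchII §2 Def 2.3 (i), kurims p.67) -/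
theorem card_Hpm : Nat.card (Hpm l) = l := by
  rw [Hpm, ← Nat.card_congr (MonoidHom.ofInjective (ιpm_injective l)).toEquiv,
    Nat.card_congr (Multiplicative.toAdd : Multiplicative (ZMod l) ≃ ZMod l), Nat.card_zmod]

/-- `|Π̂^cor_v| = 2 l²`. [claim: Mochizuki2012, status: disputed] (IUTchII §2 Def 2.3 (i), kurims p.67) -/
theorem card_Amb : Nat.card (Amb l) = 2 * (l * l) := by
  rw [Nat.card_congr (Multiplicative.toAdd : Amb l ≃ ZMod 2 × (ZMod l × ZMod l)), Nat.card_prod,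
    Nat.card_prod, Nat.card_zmod, Nat.card_zmod]

/-- `[Π̂^cor_v : Π^±_v] = 2l` (for `l ≠ 0`). [claim: Mochizuki2012, status: disputed] (IUTchII §2 Def 2.3 (i), kurims p.67) -/
theorem index_Hpm (hl : l ≠ 0) : (Hpm l).index = 2 * l := by
  have h := (Hpm l).index_mul_card
  rw [card_Hpm, card_Amb] at h
  have : (Hpm l).index * l = (2 * l) * l := by rw [h]; ring
  exact Nat.eq_of_mul_eq_mul_right (Nat.pos_of_ne_zero hl) this

/-! ## 2. The [IUTchII] §1 setting of the toy (`k := ℂ`, `G_v := 1`, `Π_v := 1`, trivial model environment) -/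

section Setting

variable (p : ℕ) (hl : l.Prime) (hl2 : l ≠ 2) (hp : p.Prime) (hp2 : p ≠ 2) (hpl : p ≠ l)

/-- **The toy `ThetaSetting`** ([IUTchII] §1 p. 20): `N := 1`, `k := ℂ` (`ζ_{4l} = e^{2πi/4l}`), `Π_v := 1`
(the trivial subgroup of `Π̂^cor_v`, discrete), `G_v := ℤ/1`, model `Π^tp_{Y̲}[μ_N] := ℤ/1` with `D := ⊤` and no
theta subgroups. [claim: Mochizuki2012, status: disputed] (IUTchII §1, kurims p.20) -/
@[reducible] def cyclicThetaSetting : ThetaSetting.{0} where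
  N := 1
  l := l
  l_prime := hl
  l_odd := hl2
  p := p
  p_prime := hp
  p_odd := hp2
  p_ne_l := hpl
  k := ℂ
  hasPrimitiveRoot := ⟨Complex.exp (2 * Real.pi * Complex.I / (4 * l : ℕ)),
    Complex.isPrimitiveRoot_exp (4 * l) (by have := hl.pos; omega)⟩
  PiX := TopGroup.of (↥(⊥ : Subgroup (Amb l)))
  Gk := TopGroup.of (Multiplicative (ZMod 1))
  aug := 1
  aug_continuous := continuous_of_discreteTopology
  aug_surjective := fun _ => ⟨1, Subsingleton.elim _ _⟩
  modelPi := TopGroup.of (Multiplicative (ZMod 1))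
  modelD := ⊤
  modelD_inn := le_top
  modelD_continuous := fun φ _ => ⟨continuous_of_discreteTopology, continuous_of_discreteTopology⟩
  modelTheta := ∅

/-- **The toy `BadPlaceSetting`** ([IUTchII] Prop 2.1 / Def 2.3 (i)): `Π^tp_{X_v} := 0 × 0 × ℤ/l ⊆ Π̂^cor_v` with
`Π_v = 1 ↪ Π^tp_{X_v}` the inclusion, and reference coverings `Π^tp_{Ÿ_v} = Π^tp_{Y_v} := ⊤`.
[claim: Mochizuki2012, status: disputed] (IUTchII §2 Prop 2.1, kurims pp.64-65) -/
@[reducible] def cyclicBadPlaceSetting : BadPlaceSetting.{0} where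
  toThetaSetting := cyclicThetaSetting l p hl hl2 hp hp2 hpl
  PiXplain := TopGroup.of (↥(Hpm l))
  inclPlain := Subgroup.inclusion bot_le
  inclPlain_isOpenEmbedding :=
    Topology.IsOpenEmbedding.of_continuous_injective_isOpenMap continuous_of_discreteTopology
      (Subgroup.inclusion_injective _) (fun _ _ => isOpen_discrete _)
  refY := ⊤
  refYdd := ⊤
  refYdd_le := le_rfl
  isOpen_refY := isOpen_discrete _
  isOpen_refYdd := isOpen_discrete _

/-- **The toy `TemperedCoverings`** over `P := Π_v` itself: the reference diagram, «corresponding» to itself by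
the identity. [claim: Mochizuki2012, status: disputed] (IUTchII §2 Prop 2.1, kurims pp.64-65) -/
@[reducible] def cyclicCoverings : TemperedCoverings (cyclicBadPlaceSetting l p hl hl2 hp hp2 hpl)
    (cyclicBadPlaceSetting l p hl hl2 hp hp2 hpl).PiX where
  isoRef := ⟨ContinuousMulEquiv.refl _⟩
  Xplain := (cyclicBadPlaceSetting l p hl hl2 hp hp2 hpl).PiXplain
  incl := (cyclicBadPlaceSetting l p hl hl2 hp hp2 hpl).inclPlain
  incl_isOpenEmbedding := (cyclicBadPlaceSetting l p hl hl2 hp hp2 hpl).inclPlain_isOpenEmbedding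
  Y := ⊤
  Ydd := ⊤
  Ydd_le := le_rfl
  isOpen_Y := isOpen_discrete _
  isOpen_Ydd := isOpen_discrete _
  corresponds := ⟨ContinuousMulEquiv.refl _, ContinuousMulEquiv.refl _, fun _ => rfl,
    Subgroup.map_id ⊤, Subgroup.map_id ⊤⟩

/-! ## 3. The tower `Π_v ⊆ Π^±_v ⊆ Π̂^cor_v` of Def 2.3 (i) in the toy -/

/-- **The toy `PlusMinusTower`** ([IUTchII] Def 2.3 (i) p. 67): `Π̂^cor_v = Π^cor_v := ℤ/2 × ℤ/l × ℤ/l`,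
`Π̂^±_v := 0 × 0 × ℤ/l` (the image of `Π^tp_{X_v}`), `Π̂_v := 1`, `G_v := 1` — so `Δ̂ = Π̂` throughout and the
printed indices `l`, `2l` hold. [claim: Mochizuki2012, status: disputed] (IUTchII §2 Def 2.3 (i), kurims p.67) -/
@[reducible] def cyclicTower : PlusMinusTower (cyclicCoverings l p hl hl2 hp hp2 hpl) where
  Corhat := TopGroup.of (Amb l)
  cor := ⊤
  pmHat := Hpm l
  hat := ⊥
  emb := (Hpm l).subtype
  emb_injective := Subtype.val_injective
  aug := 1
  aug_surjective := fun _ => ⟨1, Subsingleton.elim _ _⟩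
  hat_le_pmHat := bot_le
  emb_le_pmHat := by rw [Subgroup.range_subtype]
  embP_le_hat := by
    rintro _ ⟨x, rfl⟩
    rw [Subgroup.mem_bot]
    have hx : (x : ↥(⊥ : Subgroup (Amb l))).1 = 1 := x.2
    change ((Subgroup.inclusion bot_le x : ↥(Hpm l)) : Amb l) = 1
    simpa using hx
  embP_le_cor := le_top
  pmHat_normal := Subgroup.normal_of_isMulCommutative _
  deltaHat_normal := Subgroup.normal_of_isMulCommutative _
  deltaHat_index := by
    show ((⊥ ⊓ (1 : Amb l →* Multiplicative (ZMod 1)).ker).subgroupOf _).index = l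
    rw [bot_inf_eq, Subgroup.bot_subgroupOf, Subgroup.index_bot, MonoidHom.ker_one, inf_top_eq, card_Hpm]
  deltaPmHat_normal := Subgroup.normal_of_isMulCommutative _
  deltaPmHat_index := by
    show ((Hpm l ⊓ (1 : Amb l →* Multiplicative (ZMod 1)).ker).subgroupOf
      (1 : Amb l →* Multiplicative (ZMod 1)).ker).index = 2 * l
    rw [MonoidHom.ker_one, inf_top_eq]
    change (Hpm l).relIndex ⊤ = 2 * l
    rw [Subgroup.relIndex_top_right, index_Hpm l hl.ne_zero]
  aug_compat := ⟨ContinuousMulEquiv.refl _, fun _ => Subsingleton.elim _ _⟩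

/-! ## 4. The covering-shape side hypotheses of Cor 2.4 (i) hold in the toy (jointly with the tower axioms) -/

/-- `Π^±_v ∩ Π̂_v ⊆ Π_v` in the toy (hypothesis `hinf` of `cor24_i'_of_hatData`).
[claim: Mochizuki2012, status: disputed] (IUTchII §2 Def 2.3 (i), kurims p.67) -/
theorem piPM_inf_hat_le_piV :
    (cyclicTower l p hl hl2 hp hp2 hpl).piPM ⊓ (cyclicTower l p hl hl2 hp hp2 hpl).hat ≤
      (cyclicTower l p hl hl2 hp hp2 hpl).piV := by
  intro x hx
  have hx' : x ∈ (⊥ : Subgroup (Amb l)) := hx.2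
  rw [Subgroup.mem_bot] at hx'
  rw [hx']
  exact Subgroup.one_mem _

/-- `Δ^±_v ⊄ Δ̂_v` in the toy (hypothesis `hnot` of `cor24_i'_of_hatData`): `Π^±_v = 0 × 0 × ℤ/l` is not
trivial for a prime `l`. [claim: Mochizuki2012, status: disputed] (IUTchII §2 Def 2.3 (i), kurims p.67) -/
theorem not_piPM_inf_ker_le_hat :
    ¬ ((cyclicTower l p hl hl2 hp hp2 hpl).piPM ⊓ (cyclicTower l p hl hl2 hp hp2 hpl).aug.ker ≤
      (cyclicTower l p hl hl2 hp hp2 hpl).hat) := by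
  intro h
  haveI : Fact (1 < l) := ⟨hl.one_lt⟩
  -- the element `(0, 0, 1)` of `Π^±_v` would lie in `Π̂_v = 1`
  have hmem : ιpm l (ofAdd 1) ∈
      (cyclicTower l p hl hl2 hp hp2 hpl).piPM ⊓ (cyclicTower l p hl hl2 hp hp2 hpl).aug.ker := by
    refine ⟨?_, ?_⟩
    · show ιpm l (ofAdd 1) ∈ (Hpm l).subtype.range
      rw [Subgroup.range_subtype]
      exact ⟨ofAdd 1, rfl⟩
    · exact MonoidHom.mem_ker.mpr (Subsingleton.elim _ _)
  have h1 : ιpm l (ofAdd 1) = 1 := (Subgroup.mem_bot).mp (h hmem)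
  have h2 := congrArg (fun x : Amb l => (toAdd x).2.2) h1
  simp [ιpm] at h2

end Setting

/-- **A closed instance**: `l := 3`, `p := 5`. The interfaces `ThetaSetting`, `BadPlaceSetting`,
`TemperedCoverings`, `PlusMinusTower` are jointly inhabited in the kernel.
[claim: Mochizuki2012, status: disputed] (IUTchII §2 Def 2.3 (i), kurims p.67) -/
theorem nonempty_plusMinusTower :
    Nonempty (PlusMinusTower (cyclicCoverings 3 5 Nat.prime_three (by decide) Nat.prime_five (by decide)
      (by decide))) :=
  ⟨cyclicTower 3 5 Nat.prime_three (by decide) Nat.prime_five (by decide) (by decide)⟩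

end CyclicToy

end Literature.IUT.HodgeArakelov

end
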